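import Summits.CriticalPhenomena.PercolationContinuityZ3.Theorems.PercNearOneGluingNoHeavyQuantDIBStarCorner
import Summits.CriticalPhenomena.PercolationContinuityZ3.Theorems.PercNearOneGluingNoHeavyQuantDIBCornerOneLight
import HarnessLib

/-!
# QUANT lane R8, Conjecture DIB\* — the corner `DIBStarCorner` holds whenever at most ONE light blob is non-empty

builds on p205010 (kernel theorem, internal audit signed; external expert review pending)

Support file (`--supports stmt-CriticalPhenomena-4575`), QUANT lane typer seat prim-quant-stmt (gen 18), rung R8 of
`run/shared/lean/prim/quant/LADDER.md`.  Theorems only, no sorries, standard axioms.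

`Quant.IndepBlob.DIBStarCorner x` (`…QuantDIBStarCorner`, typer g17) is the one part of Conjecture DIB\* (`…QuantDIBStar`) not in the
kernel: floor `1/2 < x`, light blobs (`g k < x`) of size `≤ j`, heavy sizes totalling `≤ 2j`, a non-empty light blob present,
discounted credit `> 2j` ⟹ `x ≤ P(N ≥ j+1)`.  prim-quant-census-1 g14 proved the instance with EXACTLY ONE light blob, all other
blobs heavy (`IndepBlob.dibCorner_of_oneLight`, `…QuantDIBCornerOneLight`, p253963), and asked (lane INBOX 07:07Z) for the corner's own
binder shape: there blobs with `g k < x` and `a k = 0` ("dead lights") are neither heavy nor non-empty lights.  This file does the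
bookkeeping: glue every zero-size blob's gate to `1` (the law of `N` is unchanged, `IndepBlob.sum_weight_mul_glue`), after which the
dead lights are heavy and census-1's theorem applies verbatim.

* `Quant.IndepBlob.dibStarCorner_of_oneLight` — every instance of `DIBStarCorner x` (`1/2 ≤ x < 1`) whose NON-EMPTY light blobs
  form a singleton satisfies the corner's conclusion.  What remains OPEN of DIB\*: instances with `≥ 2` non-empty light blobs
  (README V191/V192; lead g16 LEAD-NOTES-G16 N30: some not mergeable by p1 g11's `tail_ge_of_gradedMerge`).

[this work]; the one-light row: prim-quant-census-1 g14 (this lane); the gluing rows served [cite: KozmaNitzan2024, Conjecture 3 (p. 15)].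
-/

namespace Summit.CriticalPhenomena.PercolationContinuityZ3.Theorems

namespace Quant

namespace IndepBlob

open Finset

/-- **The DIB\* corner with at most one non-empty light blob.**  In the binder shape of `DIBStarCorner x`: gates in `[0,1]`,
light blobs of size `≤ j`, heavy total `≤ 2j`, discounted credit `> 2j`, floor `1/2 ≤ x < 1`; if `ℓ` is a non-empty light blob and
every OTHER light blob is empty, then `x ≤ P(N ≥ j+1)`.  (Glue the empty blobs' gates to `1`, then `dibCorner_of_oneLight`.) [this work] -/
theorem dibStarCorner_of_oneLight {x : ℝ} (hx : 1 / 2 ≤ x) (hx1 : x < 1) {ι : Type*} [Fintype ι] [DecidableEq ι]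
    (a : ι → ℕ) (g : ι → ℝ) (j : ℕ) (hg : ∀ k, 0 ≤ g k ∧ g k ≤ 1) (hlight : ∀ k, g k < x → a k ≤ j)
    (hcorner : ∑ k ∈ Finset.univ.filter (fun k => x ≤ g k), a k ≤ 2 * j)
    (ℓ : ι) (hℓ : g ℓ < x) (hℓa : 0 < a ℓ) (huniq : ∀ k, g k < x → 0 < a k → k = ℓ)
    (hcredit : (2 * j : ℝ) < ∑ k, (a k : ℝ) * (if x ≤ g k then g k else (g k - x ^ 2) / (1 - x))) :
    x ≤ ∑ W : Finset ι, (∏ k, if k ∈ W then g k else 1 - g k) * (if j + 1 ≤ ∑ k ∈ W, a k then (1 : ℝ) else 0) := by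
  -- glued gates: empty blobs get gate `1`
  set g' : ι → ℝ := fun k => if ((a k : ℝ)) = 0 then 1 else g k with hg'def
  have hg'eq : ∀ k, g' k = if a k = 0 then 1 else g k := fun k => by
    simp only [hg'def, Nat.cast_eq_zero]
  have hg' : ∀ k, 0 ≤ g' k ∧ g' k ≤ 1 := fun k => by
    rw [hg'eq k]; split_ifs
    · norm_num
    · exact hg k
  -- the law of `N` is unchanged by the gluing
  have hglue : ∑ W : Finset ι, (∏ k, if k ∈ W then g' k else 1 - g' k) * (if j + 1 ≤ ∑ k ∈ W, a k then (1 : ℝ) else 0) =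
      ∑ W : Finset ι, (∏ k, if k ∈ W then g k else 1 - g k) * (if j + 1 ≤ ∑ k ∈ W, a k then (1 : ℝ) else 0) := by
    have key := sum_weight_mul_glue g (fun k => (a k : ℝ)) (fun W => if j + 1 ≤ ∑ k ∈ W, a k then (1 : ℝ) else 0)
      (fun k₀ s hk₀ hs => by
        have hk₀' : a k₀ = 0 := by exact_mod_cast hk₀
        simp only [Finset.sum_insert hs, hk₀', zero_add])
    simpa only [hg'def] using key
  rw [← hglue]
  -- census-1 g14's one-light corner row for the glued system
  have hℓ' : g' ℓ < x := by rw [hg'eq ℓ, if_neg (by omega)]; exact hℓ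
  have hheavy' : ∀ k, k ≠ ℓ → x ≤ g' k := by
    intro k hk
    rw [hg'eq k]
    split_ifs with h0
    · exact hx1.le
    · by_contra hlt
      exact hk (huniq k (not_le.1 hlt) (Nat.pos_of_ne_zero h0))
  -- heavy total off `ℓ`: the non-heavy blobs other than `ℓ` are empty
  have hcorner' : (∑ k ∈ (Finset.univ : Finset ι).erase ℓ, (a k : ℝ)) ≤ 2 * j := by
    have hnat : ∑ k ∈ (Finset.univ : Finset ι).erase ℓ, a k ≤ ∑ k ∈ Finset.univ.filter (fun k => x ≤ g k), a k := by
      rw [← Finset.sum_filter_add_sum_filter_not ((Finset.univ : Finset ι).erase ℓ) (fun k => x ≤ g k) a]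
      have hz : ∑ k ∈ ((Finset.univ : Finset ι).erase ℓ).filter (fun k => ¬ x ≤ g k), a k = 0 := by
        refine Finset.sum_eq_zero fun k hk => ?_
        rw [Finset.mem_filter, Finset.mem_erase] at hk
        by_contra h0
        exact hk.1.1 (huniq k (not_le.1 hk.2) (Nat.pos_of_ne_zero h0))
      rw [hz, add_zero]
      exact Finset.sum_le_sum_of_subset_of_nonneg
        (fun k hk => by
          rw [Finset.mem_filter] at hk ⊢
          exact ⟨Finset.mem_univ k, hk.2⟩)
        (fun _ _ _ => Nat.zero_le _)
    have : ((∑ k ∈ (Finset.univ : Finset ι).erase ℓ, a k : ℕ) : ℝ) ≤ ((2 * j : ℕ) : ℝ) := by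
      exact_mod_cast hnat.trans hcorner
    push_cast at this
    exact this
  -- the credit is the same number
  have hcredit' : (2 * j : ℝ) <
      (∑ k ∈ (Finset.univ : Finset ι).erase ℓ, (a k : ℝ) * g' k) + a ℓ * ((g' ℓ - x ^ 2) / (1 - x)) := by
    have hsplit := (Finset.add_sum_erase (Finset.univ : Finset ι)
      (fun k => (a k : ℝ) * (if x ≤ g k then g k else (g k - x ^ 2) / (1 - x))) (Finset.mem_univ ℓ))
    rw [← hsplit, if_neg (not_le.2 hℓ)] at hcredit
    have hgℓ : g' ℓ = g ℓ := by rw [hg'eq ℓ, if_neg (by omega)]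
    rw [hgℓ, add_comm]
    refine hcredit.trans_le (add_le_add_right (le_of_eq (Finset.sum_congr rfl fun k hk => ?_)) _)
    have hkℓ : k ≠ ℓ := (Finset.mem_erase.1 hk).1
    rw [hg'eq k]
    by_cases h0 : a k = 0
    · rw [h0, Nat.cast_zero, zero_mul, zero_mul]
    · rw [if_neg h0]
      have hxk : x ≤ g k := by
        by_contra hlt
        exact hkℓ (huniq k (not_le.1 hlt) (Nat.pos_of_ne_zero h0))
      rw [if_pos hxk]
  exact dibCorner_of_oneLight x hx hx1 a g' j hg' ℓ hℓ' (hlight ℓ hℓ) hheavy' hcorner' hcredit'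

end IndepBlob

end Quant

end Summit.CriticalPhenomena.PercolationContinuityZ3.Theorems
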